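import Summits.CriticalPhenomena.PercolationContinuityZ3.Theorems.PercNearOneGluingNoHeavyLowerTailSahiSymCubeFiveAll
import Summits.CriticalPhenomena.PercolationContinuityZ3.Theorems.PercNearOneGluingNoHeavyLowerTailSahiInterpSound
import Summits.CriticalPhenomena.PercolationContinuityZ3.Theorems.PercNearOneGluingNoHeavyLowerTailSahiSymCubeFive10A
import Summits.CriticalPhenomena.PercolationContinuityZ3.Theorems.PercNearOneGluingNoHeavyLowerTailSahiSymCubeFive10B
import Literature.Combinatorics.Sahi2008.GeneratingFunction

/-!
# SAHI'S `C_10` ON THE CUBE `{0,1}^5` — AND HENCE SAHI'S CONJECTURE AT EVERY ORDER FOR EVERY PRODUCT MEASURE ON AT MOST FIVE COORDINATES (Lean)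

Support file (cell `prim-sahi`, seat `prim-sahi-typer` gen 30; `--supports stmt-CriticalPhenomena-4575`).  Pure proofs; closure = standard axioms
+ the `native_decide` axioms of the two computational chunks …`SahiSymCubeFive10A/B` (ONE order-10 interpolation test each: the two ten-coloured
middle layers of `B_5`) + those behind …`SahiSymCubeFiveNine` (orders `≤ 9`; for the `|ι| ≤ 5` transfers also the 7 natives of the `|ι| ≤ 4`
all-orders theorem `NCopyCert.sahiPositive_bernoulliWeight_of_card_le_four`).

* `symCheckT_five_ten` : `symCheckT 5 10 (testI 5 10 hTen cTen) = true` (the symmetry-reduced coloured-antichain check of order 10 with the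
  interpolation leaf test …`SahiInterpCheck.testI`, sound by …`SahiInterpSound.testI_sound`);
* **`sahiPositive_bernoulliWeight_ten_fin_five`** — Sahi's `C_10` for five independent coins; `sahiC10_cube_five` — events form;
* **`sahiPositive_bernoulliWeight_fin_five_all`** — `SahiPositive (bernoulliWeight p) n` for EVERY `n` and every `p : Fin 5 → [0,1]`: the order-10
  core of …`SahiSymCubeFiveAll.sahiPositive_bernoulliWeight_all_fin_five_of_core_ten` is now discharged (orders `≤ 9`: …`FiveNine`; `≥ 11`: width
  collapse);
* any index type with `|ι| ≤ 5`, every order: `sahiPositive_bernoulliWeight_of_card_le_five_all`, the order dual `…Dual…`, and the events forms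
  `sahiE_ind_nonneg_of_isUpperSet_card_le_five` / `sahiE_ind_nonneg_of_isLowerSet_card_le_five` — **Sahi's `n`-function positivity
  `E_n(1_{A_1}, …, 1_{A_n}) ≥ 0` for ALL `n` and all increasing (or all decreasing) events under every product measure on at most five
  coordinates;**
* the power-series form [Sahi2008, Conj. 4; LiebSahi2021, Conj. 1.2] for these measures: `sahiSeries_coeff_nonneg_of_card_le_five` — every coefficient of
  `1 − ∏_ω (1 − Σ_i f_i(ω) t^i)^{μ_q(ω)}` is `≥ 0` for nonnegative increasing `f_i` on `Set ι`, `|ι| ≤ 5` (Sahi's Prop. 15 proves `|X| ≤ 2` for all FKG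
  measures; via the tree's `forall_sahiPositive_iff_sahiSeries` = [LiebSahi2021, Thm. 4.4]). [this work]
-/

namespace Summit.CriticalPhenomena.PercolationContinuityZ3.Theorems.SahiSymCube

open Finset PowerSeries
open Literature.Combinatorics.Sahi2008
open Literature.Probability.Percolation.DecisionTree (ind ind_nonneg)
open SahiInterp

variable {ι : Type*}

/-- **The order-10 symmetry-reduced check on `{0,1}^5` with the interpolation leaf test passes** (assembled from the two computational chunks).
[this work] -/
theorem symCheckT_five_ten : symCheckT 5 10 (testI 5 10 hTen cTen) = true :=
  symCheck_of_from (symCheckFrom_of_range symCheck_five_10_chunkA symCheck_five_10_chunkB)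

/-- **SAHI'S `C_10` FOR FIVE INDEPENDENT COINS**: `SahiPositive (bernoulliWeight p) 10` for every `p : Fin 5 → [0,1]`. [this work] -/
theorem sahiPositive_bernoulliWeight_ten_fin_five (p : Fin 5 → unitInterval) : SahiPositive (bernoulliWeight p) 10 :=
  sahiPositive_of_symCheckT (n := 8) (fun A hA p' => testI_sound A hA p') symCheckT_five_ten p
    fun _ _ hk => sahiPositive_bernoulliWeight_fin_five_of_le_nine p hk

/-- **Sahi's `C_10` on `{0,1}^5`, events form**: `E_10(μ_p; A) ≥ 0` for increasing events under every product measure. [this work] -/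
theorem sahiC10_cube_five (p : Fin 5 → unitInterval) {A : Fin 10 → Set (Set (Fin 5))} (hA : ∀ i, IsUpperSet (A i)) :
    0 ≤ sahiE (bernoulliWeight p) 10 (fun i => ind (A i)) :=
  sahiPositive_bernoulliWeight_ten_fin_five p _ (fun _ _ => ind_nonneg _ _) (fun i => monotone_ind_of_isUpperSet (hA i))

open scoped Classical in
/-- **SAHI'S CONJECTURE AT EVERY ORDER FOR FIVE INDEPENDENT COINS**: `SahiPositive (bernoulliWeight p) n` for every `n` and every
`p : Fin 5 → [0,1]` (orders `≤ 9`: the tree's theorems; order `10`: this file; `≥ 11`: width collapse, via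
…`SahiSymCubeFiveAll.sahiPositive_bernoulliWeight_all_fin_five_of_core_ten`). [this work] -/
theorem sahiPositive_bernoulliWeight_fin_five_all (p : Fin 5 → unitInterval) (n : ℕ) : SahiPositive (bernoulliWeight p) n :=
  sahiPositive_bernoulliWeight_all_fin_five_of_core_ten p (fun N c _ _ =>
    sahiPositive_bernoulliWeight_ten_fin_five p _ (fun _ _ => setInd_nonneg _ _)
      (fun i => monotone_setInd (SahiAbsorbed.isUpperSet_filter_coMember N c i))) n

/-! ## Any index type with at most five elements, every order -/

/-- **`SahiPositive (bernoulliWeight q) n` for EVERY `n` and every product weight on at most five coordinates** (all nonnegative increasing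
`f₁, …, f_n` on `Set ι`, `|ι| ≤ 5`). [this work] -/
theorem sahiPositive_bernoulliWeight_of_card_le_five_all [Fintype ι] (hι : Fintype.card ι ≤ 5) (q : ι → unitInterval) (n : ℕ) :
    SahiPositive (bernoulliWeight q) n := by
  classical
  rcases Nat.lt_or_ge (Fintype.card ι) 5 with h | h
  · exact NCopyCert.sahiPositive_bernoulliWeight_of_card_le_four (by omega) q n
  · have hcard : Fintype.card ι = 5 := le_antisymm hι h
    let e : Fin 5 ≃ ι := (finCongr hcard).symm.trans (Fintype.equivFin ι).symm
    rw [NCopyCert.bernoulliWeight_eq_pushWeight_congr e q]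
    exact (sahiPositive_bernoulliWeight_fin_five_all _ n).of_pushWeight fun s t hst => Set.image_mono hst

/-- **The order dual** (under which DECREASING events are increasing), every order, at most five coordinates. [this work] -/
theorem sahiPositive_bernoulliWeightDual_of_card_le_five_all [Fintype ι] (hι : Fintype.card ι ≤ 5) (q : ι → unitInterval) (n : ℕ) :
    SahiPositive (bernoulliWeightDual q) n := by
  rw [NCopyCert.bernoulliWeightDual_eq_pushWeight_compl]
  exact (sahiPositive_bernoulliWeight_of_card_le_five_all hι _ n).of_pushWeight (OrderIso.compl (Set ι)).monotone

/-- **Decreasing events, every order, at most five coordinates**: `E_n(1_{A_1},…,1_{A_n}) ≥ 0`. [this work] -/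
theorem sahiE_ind_nonneg_of_isLowerSet_card_le_five [Fintype ι] (hι : Fintype.card ι ≤ 5) (q : ι → unitInterval) {n : ℕ}
    (A : Fin n → Set (Set ι)) (hA : ∀ i, IsLowerSet (A i)) :
    0 ≤ sahiE (bernoulliWeight q) n (fun i => ind (A i)) :=
  sahiPositive_bernoulliWeightDual_of_card_le_five_all hι q n (fun i (a : (Set ι)ᵒᵈ) => ind (A i) (OrderDual.ofDual a))
    (fun _ _ => ind_nonneg _ _) (fun i => monotone_ind_toDual_of_isLowerSet (hA i))

/-- **Increasing events, every order, at most five coordinates**: `E_n(1_{A_1},…,1_{A_n}) ≥ 0` — Sahi's `n`-function positivity for every `n`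
under every product measure on `≤ 5` coordinates. [this work] -/
theorem sahiE_ind_nonneg_of_isUpperSet_card_le_five [Fintype ι] (hι : Fintype.card ι ≤ 5) (q : ι → unitInterval) {n : ℕ}
    (A : Fin n → Set (Set ι)) (hA : ∀ i, IsUpperSet (A i)) :
    0 ≤ sahiE (bernoulliWeight q) n (fun i => ind (A i)) :=
  sahiPositive_bernoulliWeight_of_card_le_five_all hι q n _ (fun _ _ => ind_nonneg _ _) (fun i => monotone_ind_of_isUpperSet (hA i))

/-- **Sahi's Conjecture 4 (power-series form) for every product measure on at most five points**: all coefficients of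
`1 − ∏_ω (1 − Σ_i f_i(ω) t^i)^{μ_q(ω)}` are nonnegative for nonnegative increasing `f_1, f_2, …` on `Set ι`, `|ι| ≤ 5`. [this work] -/
theorem sahiSeries_coeff_nonneg_of_card_le_five [Fintype ι] (hι : Fintype.card ι ≤ 5) (q : ι → unitInterval) (f : ℕ → Set ι → ℝ)
    (hf0 : ∀ i ω, 0 ≤ f i ω) (hfm : ∀ i, Monotone (f i)) (M : ℕ) : 0 ≤ coeff M (sahiSeries (bernoulliWeight q) f) :=
  (forall_sahiPositive_iff_sahiSeries (bernoulliWeight q) (sum_bernoulliWeight q)).1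
    (fun n => sahiPositive_bernoulliWeight_of_card_le_five_all hι q n) f hf0 hfm M

end Summit.CriticalPhenomena.PercolationContinuityZ3.Theorems.SahiSymCube
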